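import Summits.HodgeConjecture.HodgeConjecture.Theses.SecondaryPeriods
import Summits.HodgeConjecture.HodgeConjecture.Theorems.SecondaryPeriodsConiveauOneFailureHabitat
import Literature.AlgebraicGeometry.Motives.PeriodComparison
import Literature.AlgebraicGeometry.Motives.PeriodRealizationClassical

/-!
# Strategist sketch — crux `ConiveauOneFailure` (stmt-HodgeConjecture-3540)

Signatures backing `STRATEGY-CENSUS.md` (crux-strategist s2, 2026-08-17):

* `IsHabitatPlane`, `UniversalStrengthening` (heading **Strengthen**, S⁺_all) with
  `coniveauOneFailure_of_universalStrengthening` (S⁺ ⟹ crux) and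
  `not_universalStrengthening_of_calibration` (S⁺ dies on any supported habitat plane — the
  calibration threefold `E_i³`);
* `coniveauOneFailure_of_certificate` / `exists_unsupported_of_coniveauOneFailure`
  (heading **Decomposition**: the certificate-split SCHEMA is difficulty-neutral);
* `DeRhamRationalPlane`, `DeRhamSoundness` (Sub₁), `NonDeRhamRationalAttractorPlane` (Sub₂),
  `ClassicalPeriodDataOver` (Sub₀) and the PROVED glue `coniveauOneFailure_of_deRham_split`
  (heading **Decomposition** / **Transfer**: the absolute-Hodge certificate split — typed, glued,
  NOT filed: Sub₂ is numerically false at all three rational rank-2 attractors, `P.dR` is unpinned).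
-/

set_option linter.dupNamespace false

namespace Summit.HodgeConjecture.HodgeConjecture.Cruxes.ConiveauOneFailure.Strategist

open Literature.AlgebraicGeometry.Motives Literature.AlgebraicGeometry.HodgeTheory
open Summit.HodgeConjecture.HodgeConjecture.Theses.SecondaryPeriods (LevelOneConiveauThreefolds
  ConiveauOneFailure)
open scoped TensorProduct

/-- The habitat clauses of the registered heart: rational, sub-Hodge, level one, `h^{3,0} = 1`,
rank 2 (verbatim binders of the crux plus the two habitat clauses). -/
def IsHabitatPlane {Y : SchemeOver ℂ} (A : HodgeModel 3 Y) (s : Finset (complexBetti Y 3)) : Prop :=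
  (∀ c ∈ s, IsRationalClass c) ∧
  (Submodule.span ℂ (↑s : Set (complexBetti Y 3))).map (A.pullback 3).hom =
    (⨆ (p : ℕ) (q : ℕ) (_ : p + q = 3),
      (Submodule.span ℂ (↑s : Set (complexBetti Y 3))).map (A.pullback 3).hom ⊓ A.hodgePQ 3 p q) ∧
  (Submodule.span ℂ (↑s : Set (complexBetti Y 3))).map (A.pullback 3).hom ≤
    (⨆ (p : ℕ) (q : ℕ) (_ : p + q = 3) (_ : 1 ≤ p) (_ : 1 ≤ q), A.hodgePQ 3 p q) ∧
  Module.finrank ℂ (A.hodgePQ 3 3 0) = 1 ∧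
  Module.finrank ℂ (Submodule.span ℂ (↑s : Set (complexBetti Y 3))) = 2

/-- GHC(3,1) AT one threefold `Y` (the crux body pointwise). -/
def LevelOneConiveauAt (Y : SchemeOver ℂ) : Prop :=
  ∀ (A : HodgeModel 3 Y) (s : Finset (complexBetti Y 3)), (∀ c ∈ s, IsRationalClass c) →
    (Submodule.span ℂ (↑s : Set (complexBetti Y 3))).map (A.pullback 3).hom =
      (⨆ (p : ℕ) (q : ℕ) (_ : p + q = 3),
        (Submodule.span ℂ (↑s : Set (complexBetti Y 3))).map (A.pullback 3).hom ⊓ A.hodgePQ 3 p q) →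
    (Submodule.span ℂ (↑s : Set (complexBetti Y 3))).map (A.pullback 3).hom ≤
      (⨆ (p : ℕ) (q : ℕ) (_ : p + q = 3) (_ : 1 ≤ p) (_ : 1 ≤ q), A.hodgePQ 3 p q) →
    Submodule.span ℂ (↑s : Set (complexBetti Y 3)) ≤ supportedClasses Y 3 1

theorem levelOneConiveauAt_of_levelOneConiveauThreefolds (h : LevelOneConiveauThreefolds)
    {Y : SchemeOver ℂ} (hY : IsSmoothProjective 3 Y) : LevelOneConiveauAt Y :=
  fun A s hs hsub hlev ↦ h hY A s hs hsub hlev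

/-! ### Strengthen: S⁺_all — "EVERY habitat plane is unsupported" -/

/-- S⁺_all: every rational rank-2 level-one sub-Hodge plane of `H³` of a CY-type threefold is
unsupported. Strictly stronger than the crux (`coniveauOneFailure_of_universalStrengthening`), and
FALSE: the calibration threefold `E_i³` carries a supported habitat plane
(`not_universalStrengthening_of_calibration`). -/
def UniversalStrengthening : Prop :=
  ∀ ⦃Y : SchemeOver ℂ⦄ (_ : IsSmoothProjective 3 Y) (A : HodgeModel 3 Y) (s : Finset (complexBetti Y 3)),
    IsHabitatPlane A s → ¬ Submodule.span ℂ (↑s : Set (complexBetti Y 3)) ≤ supportedClasses Y 3 1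

theorem coniveauOneFailure_of_universalStrengthening (h : UniversalStrengthening) :
    ConiveauOneFailure := by
  obtain ⟨Y, hY, A, s, hs, hsub, hlev, h30, h2⟩ :=
    Theorems.exists_levelOnePlane_calabiYauType_ellipticCurveCubed
  intro hG
  exact h hY A s ⟨hs, hsub, hlev, h30, h2⟩ (hG hY A s hs hsub hlev)

theorem not_universalStrengthening_of_calibration
    (hcal : ∃ (Y : SchemeOver ℂ) (_ : IsSmoothProjective 3 Y) (A : HodgeModel 3 Y)
      (s : Finset (complexBetti Y 3)),
      IsHabitatPlane A s ∧ Submodule.span ℂ (↑s : Set (complexBetti Y 3)) ≤ supportedClasses Y 3 1) :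
    ¬ UniversalStrengthening := fun h ↦ by
  obtain ⟨Y, hY, A, s, hhab, hle⟩ := hcal
  exact h hY A s hhab hle

/-! ### Decomposition: the certificate-split schema is difficulty-neutral -/

/-- Any SOUND certificate predicate `Cert` plus ONE certified habitat instance gives the crux. -/
theorem coniveauOneFailure_of_certificate
    (Cert : ∀ (Y : SchemeOver ℂ), Submodule ℂ (complexBetti Y 3) → Prop)
    (hsound : ∀ ⦃Y : SchemeOver ℂ⦄ (_ : IsSmoothProjective 3 Y) (V : Submodule ℂ (complexBetti Y 3)),
      Cert Y V → ¬ V ≤ supportedClasses Y 3 1)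
    (hinst : ∃ (Y : SchemeOver ℂ) (_ : IsSmoothProjective 3 Y) (A : HodgeModel 3 Y)
      (s : Finset (complexBetti Y 3)),
      IsHabitatPlane A s ∧ Cert Y (Submodule.span ℂ (↑s : Set (complexBetti Y 3)))) :
    ConiveauOneFailure := by
  obtain ⟨Y, hY, A, s, ⟨hs, hsub, hlev, -, -⟩, hc⟩ := hinst
  intro hG
  exact hsound hY _ hc (hG hY A s hs hsub hlev)

/-- Conversely the crux itself supplies a (tautological) sound certificate with an instance: the
schema carries no difficulty of its own — everything is in a `Cert` whose soundness is proved
INDEPENDENTLY of the crux (absolute Hodge / de Rham rationality: below; Beilinson–Bloch values: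
not typable; Abel–Jacobi triviality: not typable). -/
theorem exists_unsupported_of_coniveauOneFailure (h : ConiveauOneFailure) :
    ∃ (Y : SchemeOver ℂ) (_ : IsSmoothProjective 3 Y) (A : HodgeModel 3 Y)
      (s : Finset (complexBetti Y 3)),
      (∀ c ∈ s, IsRationalClass c) ∧
      (Submodule.span ℂ (↑s : Set (complexBetti Y 3))).map (A.pullback 3).hom =
        (⨆ (p : ℕ) (q : ℕ) (_ : p + q = 3),
          (Submodule.span ℂ (↑s : Set (complexBetti Y 3))).map (A.pullback 3).hom ⊓
            A.hodgePQ 3 p q) ∧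
      (Submodule.span ℂ (↑s : Set (complexBetti Y 3))).map (A.pullback 3).hom ≤
        (⨆ (p : ℕ) (q : ℕ) (_ : p + q = 3) (_ : 1 ≤ p) (_ : 1 ≤ q), A.hodgePQ 3 p q) ∧
      ¬ Submodule.span ℂ (↑s : Set (complexBetti Y 3)) ≤ supportedClasses Y 3 1 := by
  by_contra hcon
  apply h
  intro Y hY A s hs hsub hlev
  by_contra hle
  exact hcon ⟨Y, hY, A, s, hs, hsub, hlev, hle⟩

/-! ### Decomposition / Transfer: the absolute-Hodge (de Rham rationality) certificate split

`Cert_dR Y V` = "`Y = X ×_ρ ℂ` for `X` over `ℚ` and `V` is NOT the complexification of a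
`ℚ`-plane of algebraic de Rham cohomology `H³_dR(X/ℚ)`". Soundness (algebraic ⟹ absolute Hodge,
Deligne 1982 Ex. 2.1(a); here only: a supported plane is carried by an algebraic correspondence
defined over `ℚ̄`, whose de Rham realization is defined over `ℚ̄`, and the level-one plane of an
attractor is unique, so Galois descent gives `ℚ`) is a THEOREM in print. Typed on the tree's
period-realization layer (`PeriodRealization ℚ`, `P.IsClassical` pins the Betti–Hodge side ONLY —
`P.dR`/`P.iso` are unpinned, PeriodRealizationClassical module doc "NOT PINNED: clause (iii)"), for
the ATTRACTOR plane `T ⊇ F³` (rank 2, `h^{3,0} = 1`; its symplectic complement is the level-one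
plane `V`, and `T` is de Rham-rational iff `V` is). -/

/-- `T ≤ H³_B(X_ρ, ℚ)` is the complexification of a `k`-plane `W ≤ H³_dR(X/k)` under `P.iso ρ`
(spelled exactly like the de Rham clause of `AdelicCoherence.AttractorPlanesCoherent`; `k` a number
field — `k = ℚ` literally hits the `ℚ`-algebra instance diamond on `AlongHom ℂ ρ`, so `k` is kept
generic as in that route). -/
def DeRhamRationalPlane {k : Type} [Field k] [CharZero k] (ρ : k →+* ℂ) (P : PeriodRealization k)
    (X : SchemeOver k) (T : Submodule ℚ ((P.B.comap ρ).obj X 3)) : Prop :=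
  ∃ W : Submodule k (P.dR.obj X 3),
    (((W.baseChange (AlongHom ℂ ρ)).map (P.iso ρ X 3)).restrictScalars ℚ).map
        (alongHomTensorEquiv ρ ((P.B.comap ρ).obj X 3)).toLinearMap =
      (T.baseChange ℂ).restrictScalars ℚ

/-- Sub₀ (construction, shared with AdelicCoherence.ClassicalPeriodData / PeriodsPolice): a
classical period realization over the number field `k` exists. -/
def ClassicalPeriodDataOver (k : Type) [Field k] [NumberField k] : Prop :=
  ∃ P : PeriodRealization k, P.IsClassical

/-- Sub₁ (soundness of the de Rham certificate, attractor form): over a number field `k`, if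
GHC(3,1) holds AT the complex threefold `X_ρ` then every rank-2 Betti plane `T ⊇ F³H³` with
`h^{3,0} = 1` is de Rham-rational over `k`. True in print for THE de Rham realization (supported ⟹
carried by a `ℚ̄`-defined curve correspondence ⟹ `ℚ̄`-de Rham ⟹ `k` by uniqueness of the level-one
plane and Galois descent); as typed (`∀ P`, `P.dR` unpinned) exposed to exotic de Rham data. -/
def DeRhamSoundness : Prop :=
  ∀ ⦃k : Type⦄ [Field k] [NumberField k] (ρ : k →+* ℂ) (P : PeriodRealization k), P.IsClassical →
    ∀ ⦃X : SchemeOver k⦄ (_ : IsSmoothProjective 3 X)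
      (hXρ : IsSmoothProjective 3 ((baseChangeHom ρ).obj X))
      (T : Submodule ℚ ((P.B.comap ρ).obj X 3)),
      Module.finrank ℚ T = 2 → (P.B.hodge hXρ 3).F 3 ≤ T.baseChange ℂ →
      Module.finrank ℂ ((P.B.hodge hXρ 3).F 3) = 1 →
      LevelOneConiveauAt ((baseChangeHom ρ).obj X) → DeRhamRationalPlane ρ P X T

/-- Sub₂ (the instance = the bet of this split), over the number field `k`: some smooth projective
threefold over `k` carries, for every classical period realization, an attractor plane that is NOT
de Rham-rational — i.e. the attractor projector is not absolute Hodge (¬ Charles–Schnell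
Conj. 11.2.17 there). NUMERICALLY FALSE (k = ℚ) at the three rational rank-2 attractors (Yang 2021
§4.2; Bönisch–Klemm–Scheidegger–Zagier 2024 §3.3, rational matrices `A`, `B`; Bönisch thesis §5.2). -/
def NonDeRhamRationalAttractorPlane (k : Type) [Field k] [NumberField k] : Prop :=
  ∃ (ρ : k →+* ℂ) (X : SchemeOver k) (_ : IsSmoothProjective 3 X)
    (hXρ : IsSmoothProjective 3 ((baseChangeHom ρ).obj X)),
    ∀ (P : PeriodRealization k), P.IsClassical →
      ∃ T : Submodule ℚ ((P.B.comap ρ).obj X 3),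
        Module.finrank ℚ T = 2 ∧ (P.B.hodge hXρ 3).F 3 ≤ T.baseChange ℂ ∧
        Module.finrank ℂ ((P.B.hodge hXρ 3).F 3) = 1 ∧ ¬ DeRhamRationalPlane ρ P X T

/-- The glue of the de Rham split (pure logic): Sub₀ → Sub₁ → Sub₂ → crux. -/
theorem coniveauOneFailure_of_deRham_split {k : Type} [Field k] [NumberField k]
    (h₀ : ClassicalPeriodDataOver k) (h₁ : DeRhamSoundness)
    (h₂ : NonDeRhamRationalAttractorPlane k) : ConiveauOneFailure := by
  obtain ⟨P, hP⟩ := h₀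
  obtain ⟨ρ, X, hX, hXρ, hbad⟩ := h₂
  obtain ⟨T, hT2, hF, hF1, hnot⟩ := hbad P hP
  intro hG
  exact hnot (h₁ ρ P hP hX hXρ T hT2 hF hF1
    (levelOneConiveauAt_of_levelOneConiveauThreefolds hG hXρ))

end Summit.HodgeConjecture.HodgeConjecture.Cruxes.ConiveauOneFailure.Strategist
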